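import Literature.AlgebraicGeometry.Motives.ProjectiveSpaceLinearSubst
import Literature.AlgebraicGeometry.Motives.IntegralProjectiveSpace
import HarnessLib

/-!
# Linear maps `ℙʳ_k → ℙᴺ_k` between projective spaces of different dimensions

For a field `k` and linear forms `τ₀, …, τ_N ∈ k[y₀, …, y_r]` the substitution `xᵢ ↦ τᵢ` is a graded
`k`-algebra homomorphism `σ_τ : k[x₀, …, x_N] → k[y₀, …, y_r]` (`ProjectiveSpace.linSubstGraded`,
Mathlib `GradedRingHom` / `IsHomogeneous.aeval`). When every variable `y_j` is one of the `τᵢ` the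
irrelevant ideal of the target is generated by the image of that of the source
(`irrelevant_le_map_linSubstGraded`), so Mathlib's functoriality of `Proj`
(`AlgebraicGeometry.Proj.map`) gives the **linear map of projective spaces**
`ProjectiveSpace.linSubstMap τ : ℙʳ_k ⟶ ℙᴺ_k` over `k` (`linSubstMapHom_comp_projToSpec`, checked
on the cover by the `D₊(σ_τ s)` exactly as for the square case `Motives/ProjectiveSpaceLinearSubst`,
of which this file is the rectangular variant with the same proof skeleton), together with its
action on points: the homogeneous prime of the image of `𝔮` is `σ_τ⁻¹(𝔮)`
(`mem_asHomogeneousIdeal_linSubstMap_iff`), whence `ℙʳ` lands in `V₊(S)` for every set `S` of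
forms killed by `σ_τ` (`linSubstMap_mem_zeroLocus_of_aeval_eq_zero`). Typical use: the
parametrisation `ℙʳ ≅ L ⊆ ℙᴺ` of a linear subspace (Hartshorne II Example 7.1.1, I Ex. 2.11), e.g.
Shioda's linear subspaces of the Fermat variety (`HodgeTheory/FermatLinearSubspaceClass`).
Everything is proved; no named facts.

## References

* R. Hartshorne, *Algebraic Geometry*, GTM 52 (1977): II Ex. 2.14, II Example 7.1.1. [Hartshorne1977]
-/

noncomputable section

open CategoryTheory AlgebraicGeometry HomogeneousLocalization MvPolynomial

universe u

namespace Literature.AlgebraicGeometry.Motives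

namespace ProjectiveSpace

variable {k : Type u} [Field k] {N r : ℕ}

attribute [local instance] MvPolynomial.gradedAlgebra ProjBaseChange.algebraBase

/-- The grading of the source ring `k[x₀, …, x_N]` by degree. -/
local notation "𝓐" => MvPolynomial.homogeneousSubmodule (Fin (N + 1)) k
/-- The grading of the target ring `k[y₀, …, y_r]` by degree. -/
local notation "𝓑" => MvPolynomial.homogeneousSubmodule (Fin (r + 1)) k

section LinSubst

variable (τ : Fin (N + 1) → MvPolynomial (Fin (r + 1)) k) (hτ : ∀ i, (τ i).IsHomogeneous 1)

/-- **The substitution `xᵢ ↦ τᵢ(y)` by linear forms in other variables, as a graded ring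
homomorphism `k[x₀, …, x_N] → k[y₀, …, y_r]`** (Mathlib `MvPolynomial.aeval`; degrees are preserved
by `IsHomogeneous.aeval`). [cite: Hartshorne1977, II Ex. 2.14] -/
def linSubstGraded : 𝓐 →+*ᵍ 𝓑 where
  __ := (aeval τ : MvPolynomial (Fin (N + 1)) k →ₐ[k] MvPolynomial (Fin (r + 1)) k).toRingHom
  map_mem {i x} hx := by
    have h := ((mem_homogeneousSubmodule i x).mp hx).aeval τ hτ
    rw [one_mul] at h
    exact (mem_homogeneousSubmodule i _).mpr h

/-- `linSubstGraded τ` is `aeval τ` on elements (`rfl`). [folklore] -/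
@[simp]
theorem linSubstGraded_apply (p : MvPolynomial (Fin (N + 1)) k) : linSubstGraded τ hτ p = aeval τ p := rfl

open HomogeneousIdeal in
/-- **A linear substitution hitting every variable generates the irrelevant ideal**: if each `y_j`
is some `τᵢ`, then `k[y]₊ ≤ σ_τ(k[x]₊)·k[y]` (the hypothesis of Mathlib's `Proj.map`). [folklore] -/
theorem irrelevant_le_map_linSubstGraded (hgen : ∀ j : Fin (r + 1), ∃ i, τ i = X j) :
    𝓑₊ ≤ (𝓐₊).map (linSubstGraded τ hτ) := by
  rw [← toIdeal_le_toIdeal_iff, toIdeal_map]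
  refine (irrelevant_le_span r k).trans (Ideal.span_le.mpr ?_)
  rintro _ ⟨j, rfl⟩
  obtain ⟨i, hi⟩ := hgen j
  rw [SetLike.mem_coe, show (X j : MvPolynomial (Fin (r + 1)) k) = linSubstGraded τ hτ (X i) by
    rw [linSubstGraded_apply, aeval_X, hi]]
  exact Ideal.mem_map_of_mem _ (mem_irrelevant_of_mem _ zero_lt_one
    ((mem_homogeneousSubmodule _ _).mpr (isHomogeneous_X k i)))

variable (hgen : ∀ j : Fin (r + 1), ∃ i, τ i = X j)

/-- **The linear map `ℙʳ_k → ℙᴺ_k`, `[y] ↦ [τ₀(y) : ⋯ : τ_N(y)]`, of a linear substitution hitting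
every variable**, as a morphism of schemes (Mathlib `Proj.map`). [cite: Hartshorne1977, II Example 7.1.1] -/
def linSubstMapHom : Proj 𝓑 ⟶ Proj 𝓐 :=
  Proj.map (linSubstGraded τ hτ) (irrelevant_le_map_linSubstGraded τ hτ hgen)

/-- `linSubstMapHom` is Mathlib's `Proj.map` (`rfl`). [folklore] -/
theorem linSubstMapHom_eq :
    linSubstMapHom τ hτ hgen =
      Proj.map (linSubstGraded τ hτ) (irrelevant_le_map_linSubstGraded τ hτ hgen) := rfl

/-- On `k[x]_{(s)} → k[y]_{(σ s)}` the map of homogeneous localizations induced by `σ_τ`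
(Mathlib `Away.map`) is compatible with the `k`-algebra structures. [folklore] -/
theorem awayMap_linSubstGraded_algebraMap (s : MvPolynomial (Fin (N + 1)) k) (c : k) :
    Away.map (linSubstGraded τ hτ) s (algebraMap k (Away 𝓐 s) c) =
      algebraMap k (Away 𝓑 (linSubstGraded τ hτ s)) c := by
  apply HomogeneousLocalization.val_injective
  rw [ProjBaseChange.val_algebraMap, ProjBaseChange.algebraMap_eq', Away.map,
    HomogeneousLocalization.map_mk, HomogeneousLocalization.val_mk]
  change Localization.mk (linSubstGraded τ hτ ↑(algebraMap k (𝓐 0) c)) ⟨linSubstGraded τ hτ 1, _⟩ = _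
  simp only [SetLike.GradeZero.coe_algebraMap, MvPolynomial.algebraMap_eq, linSubstGraded_apply,
    aeval_C, map_one]
  rw [← MvPolynomial.algebraMap_eq]
  change Localization.mk (algebraMap k (MvPolynomial (Fin (r + 1)) k) c) 1 =
    algebraMap k (Localization.Away (linSubstGraded τ hτ s)) c
  rw [Localization.mk_algebraMap]

/-- On the chart `D₊(σ_τ s) → D₊(s)` the map is `Spec (Away.map σ_τ s)`, a morphism over `Spec k`
(Mathlib `Proj.awayι_comp_map`). [folklore] -/
theorem awayι_comp_linSubstMapHom_comp_projToSpec {i : ℕ} (hi : 0 < i)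
    (s : MvPolynomial (Fin (N + 1)) k) (hs : s ∈ 𝓐 i) :
    Proj.awayι 𝓑 (linSubstGraded τ hτ s) ((linSubstGraded τ hτ).map_mem hs) hi ≫
        linSubstMapHom τ hτ hgen ≫ ProjBaseChangeRing.projToSpec (Fin (N + 1)) k =
      Proj.awayι 𝓑 (linSubstGraded τ hτ s) ((linSubstGraded τ hτ).map_mem hs) hi ≫
        ProjBaseChangeRing.projToSpec (Fin (r + 1)) k := by
  rw [linSubstMapHom_eq, Proj.awayι_comp_map_assoc _ _ hi s hs, ProjBaseChangeRing.awayι_projToSpec,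
    ProjBaseChangeRing.awayι_projToSpec, ← Spec.map_comp, ← CommRingCat.ofHom_comp]
  congr 2
  exact RingHom.ext fun c ↦ awayMap_linSubstGraded_algebraMap τ hτ s c

/-- **`linSubstMapHom` is a morphism over `Spec k`** (checked on the open cover of the source by
the `D₊(σ_τ s)`, Mathlib `Proj.mapAffineOpenCover`). [folklore] -/
theorem linSubstMapHom_comp_projToSpec :
    linSubstMapHom τ hτ hgen ≫ ProjBaseChangeRing.projToSpec (Fin (N + 1)) k =
      ProjBaseChangeRing.projToSpec (Fin (r + 1)) k := by
  refine (Proj.mapAffineOpenCover (linSubstGraded τ hτ)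
    (irrelevant_le_map_linSubstGraded τ hτ hgen)).openCover.hom_ext _ _ fun s ↦ ?_
  rw [Scheme.AffineOpenCover.openCover_f, Proj.mapAffineOpenCover_f]
  exact awayι_comp_linSubstMapHom_comp_projToSpec τ hτ hgen s.1.2 s.2 s.2.2

/-- **The linear map `ℙʳ_k → ℙᴺ_k` over `k`** attached to a linear substitution `xᵢ ↦ τᵢ(y)`
hitting every variable `y_j`. [cite: Hartshorne1977, II Example 7.1.1] -/
def linSubstMap : projectiveSpace r k ⟶ projectiveSpace N k :=
  Over.homMk (linSubstMapHom τ hτ hgen) (linSubstMapHom_comp_projToSpec τ hτ hgen)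

/-- The underlying morphism of `linSubstMap` is `Proj.map σ_τ`. [folklore] -/
@[simp]
theorem linSubstMap_left : (linSubstMap τ hτ hgen).left = linSubstMapHom τ hτ hgen := rfl

/-- **The action on points**: the homogeneous prime of the image of a point `𝔮` of `ℙʳ_k` is the
preimage `σ_τ⁻¹(𝔮)` (Mathlib `ProjectiveSpectrum.comapFun`). [folklore] -/
theorem mem_asHomogeneousIdeal_linSubstMap_iff (q : ↥(projectiveSpace r k).left)
    (p : MvPolynomial (Fin (N + 1)) k) :
    p ∈ ProjectiveSpectrum.asHomogeneousIdeal (𝒜 := 𝓐) ((linSubstMap τ hτ hgen).left.base q) ↔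
      aeval τ p ∈ ProjectiveSpectrum.asHomogeneousIdeal (𝒜 := 𝓑) q :=
  Iff.rfl

/-- The linear map sends `ℙʳ` into the zero locus `V₊(S)` of any set of forms killed by the
substitution modulo the point: if `σ_τ p ∈ 𝔮` for all `p ∈ S` — in particular if `σ_τ p = 0` —
then the image of `𝔮` lies in `V₊(S)`. [folklore] -/
theorem linSubstMap_mem_zeroLocus_of_aeval_eq_zero (q : ↥(projectiveSpace r k).left)
    {S : Set (MvPolynomial (Fin (N + 1)) k)} (hS : ∀ p ∈ S, aeval τ p = 0) :
    (linSubstMap τ hτ hgen).left.base q ∈ ProjectiveSpectrum.zeroLocus 𝓐 S := by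
  intro p hp
  change p ∈ ProjectiveSpectrum.asHomogeneousIdeal (𝒜 := 𝓐) ((linSubstMap τ hτ hgen).left.base q)
  rw [mem_asHomogeneousIdeal_linSubstMap_iff, hS p hp]
  exact zero_mem _

end LinSubst

end ProjectiveSpace

end Literature.AlgebraicGeometry.Motives

end
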